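import Summits.Parity.GeneralizedHardyLittlewood.Theorems.BeyondDiagonalBeatsQuarter.OffDiagDualAssembly
import HarnessLib

/-!
# Route `PrimeLevelFamEdge`, crux K_B (stmt-Parity-20343), line `diagonal_kernel_split` rev 4, plan Ω (L6′ strata) —
# **the dual multiplicity is SYMMETRIC under `(α,h₁) ↔ (β,h₂)`**, so the coprime-stratum evaluation
# `N = 𝟙[unit ∧ hyperbola]` is available whenever `α` OR `β` is a unit

`OffDiag.dualCount c α β h₁ h₂ = #{u ∈ (ℤ/c)ˣ : αu + h₁ = 0 ∧ βū + h₂ = 0}`; the substitution `u ↦ ū` exchanges the two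
conditions. In the heart's layers `α = l/d₁`, `β = m/d₂` (both `< q`), modulus `c = q(r+1)`: `α` fails to be a unit only
when `(l/d₁, r+1) > 1`, `β` only when `(m/d₂, r+1) > 1`; by the symmetry the exact coprime formula
(`OffDiagDual.dualCount_eq_ite_of_isUnit`, `OffDiag.tsum_dual_eq_tsum_switch`) covers every layer in which at least one of the
two is coprime to `r+1`, leaving only the doubly non-coprime stratum to the gcd-bounds of `OffDiagDualCountStrata`.

* `dualCount_swap` — `N_c(α,β;h₁,h₂) = N_c(β,α;h₂,h₁)`;
* `dualCount_eq_ite_of_isUnit_right` — `β` unit ⇒ `N = 𝟙[h₂ unit ∧ h₁h₂ = αβ]`;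
* `dualCount_le_one_of_isUnit_right`.

Finite algebra; theorems only; standard axioms. Helper; closes nothing.
«The programme SEARCHES and TYPES; no claim about Landau–Siegel zeros, Theorems 1–2 of arXiv:2211.02515 or
a repaired Margin232 until a kernel theorem says so.»
-/

namespace Summit.Parity.GeneralizedHardyLittlewood.Theorems.BeyondDiagonalBeatsQuarter.OffDiag

open Finset

variable {c : ℕ} [NeZero c]

/-- **Symmetry of the dual multiplicity**: `N_c(α,β;h₁,h₂) = N_c(β,α;h₂,h₁)` (`u ↦ u⁻¹` on the units). [folklore] -/
theorem dualCount_swap (α β h₁ h₂ : ZMod c) : dualCount c α β h₁ h₂ = dualCount c β α h₂ h₁ := by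
  classical
  unfold dualCount
  refine Finset.card_bij (fun u _ ↦ u⁻¹) (fun u hu ↦ ?_) (fun u _ v _ h ↦ inv_injective h) (fun v hv ↦ ?_)
  · rw [Finset.mem_filter] at hu ⊢
    exact ⟨Finset.mem_univ _, hu.2.2, by rw [inv_inv]; exact hu.2.1⟩
  · rw [Finset.mem_filter] at hv
    refine ⟨v⁻¹, ?_, inv_inv v⟩
    rw [Finset.mem_filter]
    exact ⟨Finset.mem_univ _, hv.2.2, by rw [inv_inv]; exact hv.2.1⟩

/-- **Coprime formula from the right**: if `β` is a unit mod `c`, then `N_c(α,β;h₁,h₂) = 𝟙[h₂ unit ∧ h₁h₂ = αβ]`.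
[folklore] -/
theorem dualCount_eq_ite_of_isUnit_right {β : ZMod c} (hβ : IsUnit β) (α h₁ h₂ : ZMod c) :
    dualCount c α β h₁ h₂ = if IsUnit h₂ ∧ h₁ * h₂ = α * β then 1 else 0 := by
  classical
  rw [dualCount_swap, OffDiagDual.dualCount_eq_ite_of_isUnit hβ]
  by_cases h : IsUnit h₂ ∧ h₁ * h₂ = α * β
  · rw [if_pos h, if_pos ⟨h.1, by rw [mul_comm h₂, mul_comm β]; exact h.2⟩]
  · rw [if_neg h, if_neg (fun h' ↦ h ⟨h'.1, by rw [mul_comm h₁, mul_comm α]; exact h'.2⟩)]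

/-- If `β` is a unit, the multiplicity is at most one. [folklore] -/
theorem dualCount_le_one_of_isUnit_right {β : ZMod c} (hβ : IsUnit β) (α h₁ h₂ : ZMod c) :
    dualCount c α β h₁ h₂ ≤ 1 := by
  rw [dualCount_swap]
  exact dualCount_le_one hβ α h₂ h₁

end Summit.Parity.GeneralizedHardyLittlewood.Theorems.BeyondDiagonalBeatsQuarter.OffDiag
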